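import Summits.BirchSwinnertonDyer.BirchSwinnertonDyer.Theorems.UniversalToricDescentRationalSplitIMCInclusionAtThreeClosedModuloV89
import Literature.NumberTheory.GaloisRepresentations.NearlyOrdinaryPresentationProofs
import Literature.AlgebraicGeometry.Resolution.RegularLocalRingsUFD
import HarnessLib

/-!
# NODE (D-0171) — g27 · `RationalSplitIMCInclusionAtThree` (stmt-BirchSwinnertonDyer-24207)
# Crossing-local cofactor comb: the two-variable supply may carry ANY `φ_A`-symmetric cofactor whose divisor misses the anticyclotomic line

Seat `cruxidea-stmt-BirchSwinnertonDyer-24207-1` gen 27 (planner, crux-ideate standing cover), 2026-08-31.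
Route `route-BirchSwinnertonDyer-UniversalToricDescent`; crux decl
`Summit.BirchSwinnertonDyer.BirchSwinnertonDyer.Theses.UniversalToricDescent.RationalSplitIMCInclusionAtThree`
(RATWALL: `∃ k, 3ᵏ·L ∈ Ch_Λ(X_(∅,0))·R₀⟦T⟧`).  Kind: IMPLIED-BY.  Two doors conclude the crux BY NAME (0 sorry):
`rationalSplitIMCInclusionAtThree_of_lineUnitCofactor` (all rows) and `rationalSplitIMCInclusionAtThree_of_lineSqfreeCofactor`
((SQ)+(AN) rows, through g26's (SQC) format, with g26's support (PAR) PROVED here).  «beyond-print theorem»: no.  BSD is proved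
for no curve by this file; 24207 / 32493 / 20395 / 20186 stay OPEN.

## The idea (#29, `Ideas/crossing-local-cofactor-comb.md`)
The LEAD line `Lines/ratwall_thin_comb.lean` (v12) closes 24207 modulo (E|L) ⊕ Jacquet ⊕ Nekovář ⊕ K2-rat, where K2-rat (item 32493,
`RatThinCombDvdUpToTwoAtThree`) asks the two-variable ES/supply to deliver `3^t·L₂ ∈ (G, E_m(T₂))` for a thin comb of teeth — EXACT
comb divisibility of the ♯♯-frame `L₂` itself.  The weak-reflection rigidity (`dvd_pow_mul_of_weakReflection`, tree) is stated for an
ARBITRARY `φ_A`-symmetric `F`, and the rational descent (`stub_ratDescent`, tree) only reads `F` modulo the anticyclotomic line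
`𝔞_k = (T₂ − ((1+T₁)^{3^k} − 1))`.  Hence the supply may be weakened to comb divisibility of `L₂·H` for ANY cofactor `H ∈ Λ₂(R₀)` with
(i) `φ_A H ∼ H` and (ii) `H ≡ 3^b·v (mod 𝔞_k)`, `v ∈ R₀⟦T⟧ˣ` [(CFU), all rows] — or (ii′) `H ≡ 3^b·h (mod 𝔞_k)` with `h` squarefree
away from 3 [(CFS), square rows, via g26's parity absorption].  Reading: of the whole two-variable divisor of the supplied function,
ONLY ITS GERM ALONG THE ANTICYCLOTOMIC LINE is load-bearing; exceptional-zero / interpolation-factor / Euler-factor defects of a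
two-variable construction are free wherever their divisor misses `𝔞_k` (or meets it transversally, on square rows).  Lever (five
words): «cofactor divisor misses anticyclotomic line».  No new Euler-system input; the LEAD's (E|L), J, N are consumed verbatim.

## Pieces and tags (COSTUME / WEAKER / UNDECIDED; leaves ATTACKABLE / INSTRUMENTABLE / IDEA-NEEDED / BARRIER)
* (CFU) `RatThinCombDvdLineUnitCofactorAtThree` — NEW: K2-rat's binders + the line datum `(κ, γ, k)` + the frame involution `A = A_τ`
        + the two symmetries in hand ⟹ `∃ H b v, φ_A H ∼ H ∧ H − 3^b·v ∈ 𝔞_k ∧ ThinCombDvdRat (G) (L₂·H)`.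
        [WEAKER than K2-rat (`lineUnitCofactor_of_ratThinCombDvdUpToTwo`: `H = 1`) · not COSTUME (a two-variable comb statement in a
        frame, three quantifiers below the crux) · leaf IDEA-NEEDED / BARRIER: same supply barriers as K2-rat
        (`TraceZeroHeegnerTowerAtAdditiveSplitP`, `NoAdmissiblePrimesAtThree`) — the format is what a two-variable construction with
        an EXCEPTIONAL DIVISOR OFF THE LINE delivers (e.g. removable Euler/interpolation factors `(1 − a·(1+T₁)^i(1+T₂)^j)` symmetrised,
        `3 + ℓ·φ_A(ℓ)`-type factors vanishing on translates of `𝔞_k`).]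
* (CFS) `RatThinCombDvdLineSqfreeCofactorAtThree` — NEW: as (CFU) with `H − 3^b·h ∈ 𝔞_k`, `h` squarefree away from 3 (g26's
        `IsSquarefreeUpToThree`). [WEAKER than K2-rat (`lineSqfreeCofactor_of_ratThinCombDvdUpToTwo`) and than (CFU) in intent ·
        leaf IDEA-NEEDED: transversal crossings allowed (a symmetric divisor through the CM points `χ_m` with multiplicity one).]
* (PAR) g26's `ParityAbsorptionAtThree` — PROVED here (`parityAbsorptionAtThree`): `R₀⟦T⟧` is factorial (regular local of
        dimension 2: `NearlyOrdinaryPresentationCA.isRegularLocalRing_mvPowerSeries_dvr` + Auslander–Buchsbaum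
        `uniqueFactorizationMonoid_of_isRegularLocalRing`, tree) and valuation parity (`parityAbsorption_of_prime`, any UFD).
        [g26 leaf (M) CLOSED in this node; g26's square-rows door now needs only (SQ), (AN), (SQC).]
* (E|L), (J), (N) — the LEAD's `ToricFrameExistsOfBDPFrameAtThree`, `jacquet1972_…_cone`, `nekovar2006_…` BY NAME [LEAD's tags].
* (SQ), (AN) — g14/g24/g25/g26 VERBATIM (§0) [WEAKER · ATTACKABLE, g24 S1–S3].

## Doors (kernel-checked)
* `rationalSplitIMCInclusionAtThree_of_lineUnitCofactor : (E|L) → J → N → (CFU) → RationalSplitIMCInclusionAtThree` — V89's composition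
  with `F := L₂·H` in the rigidity step and `L♮ := v·spec_{3^k} L₂` in the descent step (`u = 1, t = 0, s = b`), unit stripped at the end.
* `squarefreeCofactorInclusion_of_lineSqfreeCofactor : (E|L) → J → N → (CFS) → g26.(SQC)` and
  `rationalSplitIMCInclusionAtThree_of_lineSqfreeCofactor : (E|L) → J → N → (CFS) → (SQ) → (AN) → RationalSplitIMCInclusionAtThree`
  (through g26's door and `parityAbsorptionAtThree`).
* WEAKER-certificates: `lineUnitCofactor_of_ratThinCombDvdUpToTwo`, `lineSqfreeCofactor_of_ratThinCombDvdUpToTwo` (K2-rat ⟹ both);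
  §E: WITHOUT the symmetry clause a cofactor format is VOID — `thinCombDvdRat_T₂` (`G = T₂` comb-divides EVERY `F`, `t = 1`) and
  `not_T₂_dvd_const_pow` (`T₂ ∤ 3^a` over `ℤ`): comb membership sees nothing of the `(3,T₂)`-adic class, only `φ_A`-symmetry does
  (B-g27-1); this is why the cofactor must be `φ_A`-symmetric and why «finite tooth-product cofactors» (g26 brief (c)(α)) cannot work.

## Barrier notes (for `Literature/Barriers/BirchSwinnertonDyer/`; details in HANDOFF-cruxidea-24207-1-g27.md)
* B-g27-1 COMB-INVISIBILITY OF THE `(3,T₂)`-CLASS: `ThinCombDvdRat G F` holds for EVERY `F` as soon as `G ∈ (3, T₂)`-class primes only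
  (`T₂`, `T₂ + 3u`, …: `E_m(0) = 3`); asymmetric cofactors (products of teeth, `h·ρ(h)`) are absorbed or squared, never help.
* B-g27-2 REFLECTED-TWIN FAILS: with `G`-symmetry alone a class-(c) prime `P` and its mirror `ρP` occur in `G` with equal multiplicity
  `e`; visibility of `ρP` through the comb gives `ρP^e ∣ 3^a F`, the twin needs `2e` — `F`-symmetry (Jacquet) stays necessary.
* B-g27-3 CROSSING-LOCAL EXACTNESS IS IRREDUCIBLE: an admissible `H` has `H|_{𝔞_k} = 3^b·v ≠ 0`, so a tooth-defect family that is a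
  non-unit at infinitely many crossings `𝔞_k ∩ (E_m)` (the CM points `χ_{m}`) admits NO cofactor (`H|_{𝔞_k}` would have infinitely
  many zeros in the open disc ⟹ `= 0`).  The format frees everything EXCEPT the germs at the crossings — consistent with B-g12-2.
* B-g27-4 UNIVERSAL NORMS VANISH at an additive split `3`: `Tr_{m+1/m} → 0` on `Ê(𝔪)` up the ramified `ℤ₃`-tower and bounded `log_ω`
  denominators force `lim← E(K_{m,𝔭}) ⊗ ℤ₃ = 0`; compact Selmer universal norms are `(0,0)`-strict, `X_(∅,∅)` has `Λ`-rank 2: there is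
  no integral Heegner/BF generator to «divide the tempered family by» — every «𝐘 = 𝔥·κ» idea is void (why ± / ♭♯ decompositions exist).
* B-g27-5 LANGLANDS–TUNNELL AVATAR IS DEPTH ONE: the octahedral weight-one form `g₁ ≡ f_E (mod (1+√−2))` transfers only `λ/μ`
  (Greenberg–Vatsal), never `Ch` up to `3^k` (`ρ_{E,9}` has open image): inside B-g24-15.

References: [cite: Hida1988AIF, §5 Thm. 5.1b] [cite: Jacquet1972, §19 Thm. 19.14, Cor. 19.15] [cite: Nekovar2006, Thm. 8.9.9, Prop. 9.6.6 (ii)]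
[cite: CastellaWan2023, §2.4 Thm. 2.11, Cor. 2.12 (arXiv:1607.02019)] [cite: MazurRubin2004, Thm. 5.3.10] [cite: Matsumura1987, Thm. 19.5, Thm. 20.3]
[cite: Gu2025FiniteSlopeUniversalRS, Conj. 2.15, Rem. 2.16 (arXiv:2512.01184)] [cite: Washington1997, §7.1, §13.3]
-/

set_option linter.dupNamespace false
set_option autoImplicit false

noncomputable section

open scoped Classical MatrixGroups

namespace Summit.BirchSwinnertonDyer.BirchSwinnertonDyer.Cruxes.RationalSplitIMCInclusionAtThree.CrossingLocalCofactor

open NumberField IsDedekindDomain Field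
open Literature.NumberTheory.EllipticCurves Literature.NumberTheory.GaloisRepresentations
open Literature.NumberTheory.EllipticCurves.ModularForms
open Summit.BirchSwinnertonDyer.BirchSwinnertonDyer.Theorems.UniversalToricDescentThinComb
open Summit.BirchSwinnertonDyer.BirchSwinnertonDyer.Theorems.UniversalToricDescentRatwallThinCombLine

/-! ## §0  g26 VERBATIM (`NodeSquarefreeCofactorParityG26.lean`, namespace `…SquarefreeCofactorParity`): its module is not in the farm
snapshot, so the texts of `IsSquarefreeUpTo`, (SQ), (AN), (PAR), (SQC) and g26's door are COPIED here byte-for-byte (same statements;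
the non-torsion branch of the door cites `…CharIdealVacuity.charIdeal_eq_top_of_not_isTorsion`). Credit: g26. -/

/-- `h` is SQUAREFREE AWAY FROM `c`: every square divisor of `h` divides a power of `c`
(in `R₀⟦T⟧` with `c = 3`: the distinguished polynomial of `h` is separable; `3`-powers and units are free). -/
def IsSquarefreeUpTo {S : Type*} [CommRing S] (c h : S) : Prop :=
  ∀ x : S, x * x ∣ h → ∃ a : ℕ, x ∣ c ^ a

theorem isSquarefreeUpTo_one {S : Type*} [CommRing S] (c : S) : IsSquarefreeUpTo c 1 := by
  intro x hx
  exact ⟨0, by rw [pow_zero]; exact (dvd_mul_right x x).trans hx⟩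

theorem IsSquarefreeUpTo.of_unit_mul {S : Type*} [CommRing S] {c h u : S} (hu : IsUnit u)
    (hh : IsSquarefreeUpTo c h) : IsSquarefreeUpTo c (u * h) := by
  intro x hx
  obtain ⟨v, hv⟩ := hu.exists_left_inv
  apply hh x
  have heq : h = v * (u * h) := by rw [← mul_assoc, hv, one_mul]
  rw [heq]
  exact dvd_mul_of_dvd_right hx v

/-- **Parity absorption ⟹ membership (any commutative ring, given the parity property as a hypothesis).**
`L = u·cᵇ·L₁²` (`u` a unit), `h` squarefree away from `c`, `cᵏ·L·h ∈ (F₁²)` and the parity property of the ring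
⟹ `cᵏ'·L ∈ (F₁²)`. -/
theorem mem_span_sq_of_parity {S : Type*} [CommRing S] {c F₁ L L₁ u h : S} {b k : ℕ}
    (hpar : ∀ (G M h : S) (k : ℕ), IsSquarefreeUpTo c h → G ^ 2 ∣ c ^ k * M ^ 2 * h →
      ∃ k' : ℕ, G ^ 2 ∣ c ^ k' * M ^ 2)
    (hu : IsUnit u) (hL : L = u * c ^ b * L₁ ^ 2) (hh : IsSquarefreeUpTo c h)
    (hmem : c ^ k * L * h ∈ Ideal.span {F₁ ^ 2}) :
    ∃ k' : ℕ, c ^ k' * L ∈ Ideal.span {F₁ ^ 2} := by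
  rw [Ideal.mem_span_singleton] at hmem
  have hdvd : F₁ ^ 2 ∣ c ^ (k + b) * L₁ ^ 2 * (u * h) := by
    have heq : c ^ (k + b) * L₁ ^ 2 * (u * h) = c ^ k * L * h := by rw [hL]; ring
    rw [heq]; exact hmem
  obtain ⟨k', hk'⟩ := hpar F₁ L₁ (u * h) (k + b) (hh.of_unit_mul hu) hdvd
  refine ⟨k', ?_⟩
  rw [Ideal.mem_span_singleton]
  have heq2 : c ^ k' * L = (c ^ k' * L₁ ^ 2) * (u * c ^ b) := by rw [hL]; ring
  rw [heq2]
  exact dvd_mul_of_dvd_left hk' _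

/-- `IsSquarefreeUpToThree h := IsSquarefreeUpTo 3 h` in `R₀⟦T⟧`. -/
def IsSquarefreeUpToThree (h : Literature.NumberTheory.EllipticCurves.UnrSeries 3) : Prop :=
  IsSquarefreeUpTo ((3 : ℕ) : Literature.NumberTheory.EllipticCurves.UnrSeries 3) h

/-- **(SQ) — g14/g24/g25's `SquareCharGeneratorAtThree` VERBATIM [WEAKER (⟸ g24 (ELL)) · leaf ATTACKABLE]** `Ch_Λ(X_(∅,0))·R₀⟦T⟧ = (F₁²)`. -/
def SquareCharGeneratorAtThree : Prop :=
  ∀ (W : WeierstrassCurve ℚ) [W.IsElliptic] [W.IsGloballyMinimal] (N : ℕ) [NeZero N] (K : Type) [Field K] [NumberField K] (Dt : Literature.NumberTheory.EllipticCurves.ModularForms.ModularParametrizationData W N), Summit.BirchSwinnertonDyer.Rank1Residual.Additive.ClassO6 W 3 → W.HasSurjectiveModNGaloisRep 3 → W.analyticRank = 1 → W.conductorNorm ℤ = N → Literature.NumberTheory.EllipticCurves.IsImaginaryQuadratic K → Literature.NumberTheory.EllipticCurves.SatisfiesHeegnerHypothesis N K → ∀ (κ : Literature.NumberTheory.EllipticCurves.ZpExtension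 K 3), κ.IsAnticyclotomic → ∀ (γ : Field.absoluteGaloisGroup K) [Fact (κ.IsTopGenerator γ)] (𝔭 : IsDedekindDomain.HeightOneSpectrum (NumberField.RingOfIntegers K)), ((3 : ℕ) : NumberField.RingOfIntegers K) ∈ 𝔭.asIdeal → 𝔭.asIdeal.ramificationIdx (NumberField.RingOfIntegers ℚ) = 1 → 𝔭.asIdeal.inertiaDeg (NumberField.RingOfIntegers ℚ) = 1 → ∀ (𝔭' : IsDedekindDomain.HeightOneSpectrum (NumberField.RingOfIntegers K)), ((3 : ℕ) : NumberField.RingOfIntegers K) ∈ 𝔭'.asIdeal → 𝔭' ≠ 𝔭 → ∀ (ι' : PadicAlgCl 3 ≃+* ℂ), Summit.BirchSwinnertonDyer.BirchSwinnertonDyer.Theorems.SchneiderFree.BranchInducesPrime 3 ι' 𝔭 → ∀ (ΩK : ℂ) (Ωp : ℂ_[3]) (L : Literature.NumberTheory.EllipticCurves.UnrSeries 3), ΩK ≠ 0 → Ωp ≠ 0 → Literature.NumberTheory.EllipticCurves.IsBDPLFunction ι' 𝔭 κ γ Dt.f ΩK Ωp L → Module.IsTorsion (Literature.NumberTheory.EllipticCurves.IwasawaAlgebra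 3) (Summit.BirchSwinnertonDyer.Rank1Residual.X11b.AcSelmer.XAc (W.baseChange K) 3 κ 𝔭' ∅ γ) →
    ∃ F₁ : Literature.NumberTheory.EllipticCurves.UnrSeries 3,
      (Summit.BirchSwinnertonDyer.Rank1Residual.X11b.AcSelmer.XAc.charIdeal (W.baseChange K) 3 κ 𝔭' ∅ γ).map (PowerSeries.map (Summit.BirchSwinnertonDyer.Rank1Residual.X11b.Halves.toUnr 3)) = Ideal.span {F₁ ^ 2}

/-- **(AN) — g24/g25's `SquareRootLFunctionAtThree` VERBATIM [WEAKER — true for the BDP square · leaf ATTACKABLE]** `L = u·3^b·L₁²`. -/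
def SquareRootLFunctionAtThree : Prop :=
  ∀ (W : WeierstrassCurve ℚ) [W.IsElliptic] [W.IsGloballyMinimal] (N : ℕ) [NeZero N] (K : Type) [Field K] [NumberField K] (Dt : Literature.NumberTheory.EllipticCurves.ModularForms.ModularParametrizationData W N), Summit.BirchSwinnertonDyer.Rank1Residual.Additive.ClassO6 W 3 → W.HasSurjectiveModNGaloisRep 3 → W.analyticRank = 1 → W.conductorNorm ℤ = N → Literature.NumberTheory.EllipticCurves.IsImaginaryQuadratic K → Literature.NumberTheory.EllipticCurves.SatisfiesHeegnerHypothesis N K → ∀ (κ : Literature.NumberTheory.EllipticCurves.ZpExtension K 3), κ.IsAnticyclotomic → ∀ (γ : Field.absoluteGaloisGroup K) [Fact (κ.IsTopGenerator γ)] (𝔭 : IsDedekindDomain.HeightOneSpectrum (NumberField.RingOfIntegers K)), ((3 : ℕ) : NumberField.RingOfIntegers K) ∈ 𝔭.asIdeal → 𝔭.asIdeal.ramificationIdx (NumberField.RingOfIntegers ℚ) = 1 → 𝔭.asIdeal.inertiaDeg (NumberField.RingOfIntegers ℚ) = 1 → ∀ (𝔭' : IsDedekindDomain.HeightOneSpectrum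 (NumberField.RingOfIntegers K)), ((3 : ℕ) : NumberField.RingOfIntegers K) ∈ 𝔭'.asIdeal → 𝔭' ≠ 𝔭 → ∀ (ι' : PadicAlgCl 3 ≃+* ℂ), Summit.BirchSwinnertonDyer.BirchSwinnertonDyer.Theorems.SchneiderFree.BranchInducesPrime 3 ι' 𝔭 → ∀ (ΩK : ℂ) (Ωp : ℂ_[3]) (L : Literature.NumberTheory.EllipticCurves.UnrSeries 3), ΩK ≠ 0 → Ωp ≠ 0 → Literature.NumberTheory.EllipticCurves.IsBDPLFunction ι' 𝔭 κ γ Dt.f ΩK Ωp L → Module.IsTorsion (Literature.NumberTheory.EllipticCurves.IwasawaAlgebra 3) (Summit.BirchSwinnertonDyer.Rank1Residual.X11b.AcSelmer.XAc (W.baseChange K) 3 κ 𝔭' ∅ γ) →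
    ∃ (L₁ u : Literature.NumberTheory.EllipticCurves.UnrSeries 3) (b : ℕ), IsUnit u ∧
      L = u * ((3 : ℕ) : Literature.NumberTheory.EllipticCurves.UnrSeries 3) ^ b * L₁ ^ 2

/-- **(PAR) [NEW support · WEAKER — TRUE in the UFD `R₀⟦T⟧` (valuation parity) · leaf ATTACKABLE (M): Weierstrass preparation
(Mathlib `PowerSeries` over the complete DVR `R₀`) + unique factorisation of distinguished polynomials over `R₀`]**
PARITY ABSORPTION: `h` squarefree away from 3 and `G² ∣ 3ᵏ·M²·h` ⟹ `G² ∣ 3ᵏ'·M²`. -/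
def ParityAbsorptionAtThree : Prop :=
  ∀ (G M h : Literature.NumberTheory.EllipticCurves.UnrSeries 3) (k : ℕ), IsSquarefreeUpToThree h →
    G ^ 2 ∣ ((3 : ℕ) : Literature.NumberTheory.EllipticCurves.UnrSeries 3) ^ k * M ^ 2 * h →
    ∃ k' : ℕ, G ^ 2 ∣ ((3 : ℕ) : Literature.NumberTheory.EllipticCurves.UnrSeries 3) ^ k' * M ^ 2

/-- **(SQC) [NEW format · WEAKER as a bare statement · IMPLIED BY the crux (`h = 1`) · EQUIVALENT to it on (SQ)+(AN) rows
via (PAR) · leaf IDEA-NEEDED / BARRIER (B1 TraceZero, NoAdmissiblePrimesAtThree: no supercuspidal supply yet)]**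
SQUAREFREE-COFACTOR INCLUSION: the BDP function times SOME cofactor squarefree away from 3 lies, up to a power of 3, in
the extended characteristic ideal of `X_(∅,0)`. -/
def SquarefreeCofactorInclusionAtThree : Prop :=
  ∀ (W : WeierstrassCurve ℚ) [W.IsElliptic] [W.IsGloballyMinimal] (N : ℕ) [NeZero N] (K : Type) [Field K] [NumberField K] (Dt : Literature.NumberTheory.EllipticCurves.ModularForms.ModularParametrizationData W N), Summit.BirchSwinnertonDyer.Rank1Residual.Additive.ClassO6 W 3 → W.HasSurjectiveModNGaloisRep 3 → W.analyticRank = 1 → W.conductorNorm ℤ = N → Literature.NumberTheory.EllipticCurves.IsImaginaryQuadratic K → Literature.NumberTheory.EllipticCurves.SatisfiesHeegnerHypothesis N K → ∀ (κ : Literature.NumberTheory.EllipticCurves.ZpExtension K 3), κ.IsAnticyclotomic → ∀ (γ : Field.absoluteGaloisGroup K) [Fact (κ.IsTopGenerator γ)] (𝔭 : IsDedekindDomain.HeightOneSpectrum (NumberField.RingOfIntegers K)), ((3 : ℕ) : NumberField.RingOfIntegers K) ∈ 𝔭.asIdeal → 𝔭.asIdeal.ramificationIdx (NumberField.RingOfIntegers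 ℚ) = 1 → 𝔭.asIdeal.inertiaDeg (NumberField.RingOfIntegers ℚ) = 1 → ∀ (𝔭' : IsDedekindDomain.HeightOneSpectrum (NumberField.RingOfIntegers K)), ((3 : ℕ) : NumberField.RingOfIntegers K) ∈ 𝔭'.asIdeal → 𝔭' ≠ 𝔭 → ∀ (ι' : PadicAlgCl 3 ≃+* ℂ), Summit.BirchSwinnertonDyer.BirchSwinnertonDyer.Theorems.SchneiderFree.BranchInducesPrime 3 ι' 𝔭 → ∀ (ΩK : ℂ) (Ωp : ℂ_[3]) (L : Literature.NumberTheory.EllipticCurves.UnrSeries 3), ΩK ≠ 0 → Ωp ≠ 0 → Literature.NumberTheory.EllipticCurves.IsBDPLFunction ι' 𝔭 κ γ Dt.f ΩK Ωp L →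
    ∃ (k : ℕ) (h : Literature.NumberTheory.EllipticCurves.UnrSeries 3), IsSquarefreeUpToThree h ∧
      ((3 : ℕ) : Literature.NumberTheory.EllipticCurves.UnrSeries 3) ^ k * L * h ∈
        (Summit.BirchSwinnertonDyer.Rank1Residual.X11b.AcSelmer.XAc.charIdeal (W.baseChange K) 3 κ 𝔭' ∅ γ).map (PowerSeries.map (Summit.BirchSwinnertonDyer.Rank1Residual.X11b.Halves.toUnr 3))

/-- **WEAKER-certificate: the crux ⟹ (SQC)** on every row, with the trivial cofactor `h = 1`.  So (SQC) is a waypoint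
implied by 24207, never a costume. -/
theorem squarefreeCofactorInclusion_of_crux
    (hc : Summit.BirchSwinnertonDyer.BirchSwinnertonDyer.Theses.UniversalToricDescent.RationalSplitIMCInclusionAtThree) :
    SquarefreeCofactorInclusionAtThree := by
  intro W _ _ N _ K _ _ Dt hO6 hsurj hr1 hN hK hH κ hκ γ _ 𝔭 h𝔭 he hf 𝔭' h𝔭' hne ι' hι ΩK Ωp L hΩK hΩp hL
  obtain ⟨k, hk⟩ := hc W N K Dt hO6 hsurj hr1 hN hK hH κ hκ γ 𝔭 h𝔭 he hf 𝔭' h𝔭' hne ι' hι ΩK Ωp L hΩK hΩp hL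
  refine ⟨k, 1, isSquarefreeUpTo_one _, ?_⟩
  rw [mul_one]
  exact hk

/-- **DOOR (kernel-checked, concludes the crux BY NAME).** (SQ) ∧ (AN) ∧ (PAR) ∧ (SQC) ⟹ 24207: on a torsion row, the square
generator `F₁²` (SQ), the analytic square root (AN) and the cofactor membership (SQC) give `F₁² ∣ 3^(k+b)·L₁²·(u h)` with `u h`
squarefree away from 3; parity absorption (PAR) removes the cofactor; on a non-torsion row `Ch = Λ` and `k = 0`. -/
theorem rationalSplitIMCInclusionAtThree_of_squarefreeCofactorParity
    (hSQ : SquareCharGeneratorAtThree) (hAN : SquareRootLFunctionAtThree)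
    (hPAR : ParityAbsorptionAtThree) (hSQC : SquarefreeCofactorInclusionAtThree) :
    Summit.BirchSwinnertonDyer.BirchSwinnertonDyer.Theses.UniversalToricDescent.RationalSplitIMCInclusionAtThree := by
  intro W _ _ N _ K _ _ Dt hO6 hsurj hr1 hN hK hH κ hκ γ _ 𝔭 h𝔭 he hf 𝔭' h𝔭' hne ι' hι ΩK Ωp L hΩK hΩp hL
  by_cases htor : Module.IsTorsion (Literature.NumberTheory.EllipticCurves.IwasawaAlgebra 3) (Summit.BirchSwinnertonDyer.Rank1Residual.X11b.AcSelmer.XAc (W.baseChange K) 3 κ 𝔭' ∅ γ)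
  · obtain ⟨F₁, hCh⟩ := hSQ W N K Dt hO6 hsurj hr1 hN hK hH κ hκ γ 𝔭 h𝔭 he hf 𝔭' h𝔭' hne ι' hι ΩK Ωp L hΩK hΩp hL htor
    obtain ⟨L₁, u, b, hu, hLeq⟩ := hAN W N K Dt hO6 hsurj hr1 hN hK hH κ hκ γ 𝔭 h𝔭 he hf 𝔭' h𝔭' hne ι' hι ΩK Ωp L hΩK hΩp hL htor
    obtain ⟨k, h, hh, hmem⟩ := hSQC W N K Dt hO6 hsurj hr1 hN hK hH κ hκ γ 𝔭 h𝔭 he hf 𝔭' h𝔭' hne ι' hι ΩK Ωp L hΩK hΩp hL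
    rw [hCh] at hmem ⊢
    exact mem_span_sq_of_parity (fun G M h' k' hh' hd => hPAR G M h' k' hh' hd) hu hLeq hh hmem
  · refine ⟨0, ?_⟩
    have htop : Summit.BirchSwinnertonDyer.Rank1Residual.X11b.AcSelmer.XAc.charIdeal (W.baseChange K) 3 κ 𝔭' ∅ γ = ⊤ :=
      Summit.BirchSwinnertonDyer.BirchSwinnertonDyer.Theorems.UniversalToricDescentCharIdealVacuity.charIdeal_eq_top_of_not_isTorsion htor
    rw [htop, Ideal.map_top]; exact Submodule.mem_top

/-! ## §A  The pieces (K2-rat's binders VERBATIM, then the anticyclotomic line datum, the frame involution and the two symmetries) -/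

/-- **(CFU) LINE-UNIT COFACTOR COMB DIVISIBILITY [NEW · WEAKER than K2-rat (`H = 1`) · leaf IDEA-NEEDED / BARRIER].**
In every `𝔭`-adapted ♯♯-frame `L₂` of a ClassO6 curve, with `Ch(X₂) = (G)`, `φ_A G ∼ G`, `φ_A L₂ ∼ L₂` for the frame involution
`A = A_τ`: SOME `φ_A`-symmetric cofactor `H`, congruent to `3^b·(unit)` modulo the anticyclotomic line `𝔞_k`, makes `L₂·H` rationally
thin-comb divisible by `G`. -/
def RatThinCombDvdLineUnitCofactorAtThree : Prop :=
  ∀ (W : WeierstrassCurve ℚ) [W.IsElliptic] [W.IsGloballyMinimal] (N : ℕ) [NeZero N] (K : Type) [Field K]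
    [NumberField K] (Dt : Literature.NumberTheory.EllipticCurves.ModularForms.ModularParametrizationData W N),
  Summit.BirchSwinnertonDyer.Rank1Residual.Additive.ClassO6 W 3 → W.HasSurjectiveModNGaloisRep 3 →
  W.analyticRank = 1 → W.conductorNorm ℤ = N → IsImaginaryQuadratic K → SatisfiesHeegnerHypothesis N K →
  ∀ (𝔭 : HeightOneSpectrum (𝓞 K)), ((3 : ℕ) : 𝓞 K) ∈ 𝔭.asIdeal →
    𝔭.asIdeal.ramificationIdx (𝓞 ℚ) = 1 → 𝔭.asIdeal.inertiaDeg (𝓞 ℚ) = 1 →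
  ∀ (𝔭' : HeightOneSpectrum (𝓞 K)), ((3 : ℕ) : 𝓞 K) ∈ 𝔭'.asIdeal → 𝔭' ≠ 𝔭 →
  ∀ (ι' : PadicAlgCl 3 ≃+* ℂ), Summit.BirchSwinnertonDyer.BirchSwinnertonDyer.Theorems.SchneiderFree.BranchInducesPrime 3 ι' 𝔭 →
  ∀ (κ₁ κ₂ : ZpExtension K 3) (γ₁ γ₂ : Field.absoluteGaloisGroup K)
    [Fact (ZpExtension.IsTopGeneratorPair κ₁ κ₂ γ₁ γ₂)],
  (∀ v : HeightOneSpectrum (𝓞 K), v ≠ 𝔭 → ∀ 𝔓 ∈ v.primesAbove,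
      𝔓.inertia (Field.absoluteGaloisGroup K) ≤ κ₁.kerSubgroup) →
  Module.Finite (IwasawaAlgebra₂ 3) ((W.baseChange K).XGr₂ 3 κ₁ κ₂ 𝔭' γ₁ γ₂) →
  Module.IsTorsion (IwasawaAlgebra₂ 3) ((W.baseChange K).XGr₂ 3 κ₁ κ₂ 𝔭' γ₁ γ₂) →
  ∀ (g : IwasawaAlgebra₂ 3),
    Literature.NumberTheory.EllipticCurves.Module.charIdeal (IwasawaAlgebra₂ 3)
      ((W.baseChange K).XGr₂ 3 κ₁ κ₂ 𝔭' γ₁ γ₂) = Ideal.span {g} →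
  ∀ (ΩK' : ℂ) (C X Y : ℂ_[3]) (L₂ : PowerSeries (PowerSeries (unrIntegers 3))), ΩK' ≠ 0 → C ≠ 0 → X ≠ 0 → Y ≠ 0 →
    IsToricTwoVarLFunctionUpTo₂ C X Y ι' 𝔭 𝔭' κ₁ κ₂ γ₁ γ₂ Dt.f ΩK' L₂ →
  -- the anticyclotomic line datum of the frame: `𝔞_k = (T₂ − ((1+T₁)^{3^k} − 1))`
  ∀ (κ : ZpExtension K 3), κ.IsAnticyclotomic → ∀ (γ : Field.absoluteGaloisGroup K) [Fact (κ.IsTopGenerator γ)] (k : ℕ),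
  ZpExtension.pairKer κ₁ κ₂ ≤ κ.kerSubgroup → γ₁ * γ⁻¹ ∈ κ.kerSubgroup → γ₂ * (γ ^ (3 ^ k))⁻¹ ∈ κ.kerSubgroup →
  -- the frame involution `A = A_τ` and the two symmetries in hand (K4 from Nekovář, K3(iii) from Jacquet)
  ∀ (c : Field.absoluteGaloisGroup ℚ), c ∉ Set.range (absGaloisRestrict ℚ K) →
  ∀ (τ : Field.absoluteGaloisGroup K → Field.absoluteGaloisGroup K),
    (∀ σ, absGaloisRestrict ℚ K (τ σ) = c * (absGaloisRestrict ℚ K σ)⁻¹ * c⁻¹) →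
  ∀ (A : GL (Fin 2) ℤ_[3]), (A : Matrix (Fin 2) (Fin 2) ℤ_[3]) = IwasawaAlgebra₂.frameMatrixOf κ₁ κ₂ γ₁ γ₂ τ →
    A * A = 1 → (A : Matrix (Fin 2) (Fin 2) ℤ_[3]) 0 1 ≠ 0 →
  letI : Algebra ℤ_[3] (unrIntegers 3) := (Summit.BirchSwinnertonDyer.Rank1Residual.X11b.Halves.toUnr 3).toAlgebra
  Associated (IwasawaAlgebra₂.frameSubst (unrIntegers 3) A
      (PowerSeries.map (PowerSeries.map (Summit.BirchSwinnertonDyer.Rank1Residual.X11b.Halves.toUnr 3)) g))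
    (PowerSeries.map (PowerSeries.map (Summit.BirchSwinnertonDyer.Rank1Residual.X11b.Halves.toUnr 3)) g) →
  Associated (IwasawaAlgebra₂.frameSubst (unrIntegers 3) A L₂) L₂ →
  ∃ (H : PowerSeries (PowerSeries (unrIntegers 3))) (b : ℕ) (v : (UnrSeries 3)ˣ),
    Associated (IwasawaAlgebra₂.frameSubst (unrIntegers 3) A H) H ∧
    H - PowerSeries.map (PowerSeries.C (R := unrIntegers 3)) (((3 : ℕ) : UnrSeries 3) ^ b * (v : UnrSeries 3)) ∈
      Ideal.span {T₂ (unrIntegers 3) - ((1 + T₁ (unrIntegers 3)) ^ (3 ^ k) - 1)} ∧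
    ThinCombDvdRat (unrIntegers 3) 3
      (PowerSeries.map (PowerSeries.map (Summit.BirchSwinnertonDyer.Rank1Residual.X11b.Halves.toUnr 3)) g) (L₂ * H)

/-- **(CFS) LINE-SQUAREFREE COFACTOR COMB DIVISIBILITY [NEW · WEAKER than K2-rat · leaf IDEA-NEEDED].** As (CFU), but the cofactor's
restriction to the anticyclotomic line is `3^b·h` with `h` SQUAREFREE AWAY FROM 3 (transversal crossings allowed). -/
def RatThinCombDvdLineSqfreeCofactorAtThree : Prop :=
  ∀ (W : WeierstrassCurve ℚ) [W.IsElliptic] [W.IsGloballyMinimal] (N : ℕ) [NeZero N] (K : Type) [Field K]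
    [NumberField K] (Dt : Literature.NumberTheory.EllipticCurves.ModularForms.ModularParametrizationData W N),
  Summit.BirchSwinnertonDyer.Rank1Residual.Additive.ClassO6 W 3 → W.HasSurjectiveModNGaloisRep 3 →
  W.analyticRank = 1 → W.conductorNorm ℤ = N → IsImaginaryQuadratic K → SatisfiesHeegnerHypothesis N K →
  ∀ (𝔭 : HeightOneSpectrum (𝓞 K)), ((3 : ℕ) : 𝓞 K) ∈ 𝔭.asIdeal →
    𝔭.asIdeal.ramificationIdx (𝓞 ℚ) = 1 → 𝔭.asIdeal.inertiaDeg (𝓞 ℚ) = 1 →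
  ∀ (𝔭' : HeightOneSpectrum (𝓞 K)), ((3 : ℕ) : 𝓞 K) ∈ 𝔭'.asIdeal → 𝔭' ≠ 𝔭 →
  ∀ (ι' : PadicAlgCl 3 ≃+* ℂ), Summit.BirchSwinnertonDyer.BirchSwinnertonDyer.Theorems.SchneiderFree.BranchInducesPrime 3 ι' 𝔭 →
  ∀ (κ₁ κ₂ : ZpExtension K 3) (γ₁ γ₂ : Field.absoluteGaloisGroup K)
    [Fact (ZpExtension.IsTopGeneratorPair κ₁ κ₂ γ₁ γ₂)],
  (∀ v : HeightOneSpectrum (𝓞 K), v ≠ 𝔭 → ∀ 𝔓 ∈ v.primesAbove,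
      𝔓.inertia (Field.absoluteGaloisGroup K) ≤ κ₁.kerSubgroup) →
  Module.Finite (IwasawaAlgebra₂ 3) ((W.baseChange K).XGr₂ 3 κ₁ κ₂ 𝔭' γ₁ γ₂) →
  Module.IsTorsion (IwasawaAlgebra₂ 3) ((W.baseChange K).XGr₂ 3 κ₁ κ₂ 𝔭' γ₁ γ₂) →
  ∀ (g : IwasawaAlgebra₂ 3),
    Literature.NumberTheory.EllipticCurves.Module.charIdeal (IwasawaAlgebra₂ 3)
      ((W.baseChange K).XGr₂ 3 κ₁ κ₂ 𝔭' γ₁ γ₂) = Ideal.span {g} →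
  ∀ (ΩK' : ℂ) (C X Y : ℂ_[3]) (L₂ : PowerSeries (PowerSeries (unrIntegers 3))), ΩK' ≠ 0 → C ≠ 0 → X ≠ 0 → Y ≠ 0 →
    IsToricTwoVarLFunctionUpTo₂ C X Y ι' 𝔭 𝔭' κ₁ κ₂ γ₁ γ₂ Dt.f ΩK' L₂ →
  ∀ (κ : ZpExtension K 3), κ.IsAnticyclotomic → ∀ (γ : Field.absoluteGaloisGroup K) [Fact (κ.IsTopGenerator γ)] (k : ℕ),
  ZpExtension.pairKer κ₁ κ₂ ≤ κ.kerSubgroup → γ₁ * γ⁻¹ ∈ κ.kerSubgroup → γ₂ * (γ ^ (3 ^ k))⁻¹ ∈ κ.kerSubgroup →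
  ∀ (c : Field.absoluteGaloisGroup ℚ), c ∉ Set.range (absGaloisRestrict ℚ K) →
  ∀ (τ : Field.absoluteGaloisGroup K → Field.absoluteGaloisGroup K),
    (∀ σ, absGaloisRestrict ℚ K (τ σ) = c * (absGaloisRestrict ℚ K σ)⁻¹ * c⁻¹) →
  ∀ (A : GL (Fin 2) ℤ_[3]), (A : Matrix (Fin 2) (Fin 2) ℤ_[3]) = IwasawaAlgebra₂.frameMatrixOf κ₁ κ₂ γ₁ γ₂ τ →
    A * A = 1 → (A : Matrix (Fin 2) (Fin 2) ℤ_[3]) 0 1 ≠ 0 →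
  letI : Algebra ℤ_[3] (unrIntegers 3) := (Summit.BirchSwinnertonDyer.Rank1Residual.X11b.Halves.toUnr 3).toAlgebra
  Associated (IwasawaAlgebra₂.frameSubst (unrIntegers 3) A
      (PowerSeries.map (PowerSeries.map (Summit.BirchSwinnertonDyer.Rank1Residual.X11b.Halves.toUnr 3)) g))
    (PowerSeries.map (PowerSeries.map (Summit.BirchSwinnertonDyer.Rank1Residual.X11b.Halves.toUnr 3)) g) →
  Associated (IwasawaAlgebra₂.frameSubst (unrIntegers 3) A L₂) L₂ →
  ∃ (H : PowerSeries (PowerSeries (unrIntegers 3))) (b : ℕ) (h : UnrSeries 3),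
    Associated (IwasawaAlgebra₂.frameSubst (unrIntegers 3) A H) H ∧ IsSquarefreeUpToThree h ∧
    H - PowerSeries.map (PowerSeries.C (R := unrIntegers 3)) (((3 : ℕ) : UnrSeries 3) ^ b * h) ∈
      Ideal.span {T₂ (unrIntegers 3) - ((1 + T₁ (unrIntegers 3)) ^ (3 ^ k) - 1)} ∧
    ThinCombDvdRat (unrIntegers 3) 3
      (PowerSeries.map (PowerSeries.map (Summit.BirchSwinnertonDyer.Rank1Residual.X11b.Halves.toUnr 3)) g) (L₂ * H)

/-! ## §B  WEAKER-certificates: K2-rat (item 32493) implies both pieces with the trivial cofactor `H = 1` -/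

theorem lineUnitCofactor_of_ratThinCombDvdUpToTwo
    (hK2 : Summit.BirchSwinnertonDyer.BirchSwinnertonDyer.Theses.UniversalToricDescent.RatThinCombDvdUpToTwoAtThree) :
    RatThinCombDvdLineUnitCofactorAtThree := by
  intro W _ _ N _ K _ _ Dt hO6 hsurj hrk hN hK hH 𝔭 h3 hram hdeg 𝔭' h3' hne ι' hι κ₁ κ₂ γ₁ γ₂ _ hur₁ hfin htors g hg
    ΩK' C X Y L₂ hΩK' hC hX hY hL₂ κ hκ γ _ k hker hγ₁ hγ₂ c hc τ hτ A hA hAA hb hGsym hLsym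
  have hcomb := hK2 W N K Dt hO6 hsurj hrk hN hK hH 𝔭 h3 hram hdeg 𝔭' h3' hne ι' hι κ₁ κ₂ γ₁ γ₂ hur₁ hfin htors g hg
    ΩK' C X Y L₂ hΩK' hC hX hY hL₂
  refine ⟨1, 0, 1, ?_, ?_, ?_⟩
  · rw [map_one]
  · rw [pow_zero, Units.val_one, mul_one, map_one, sub_self]
    exact Ideal.zero_mem _
  · rw [mul_one]
    exact hcomb

theorem lineSqfreeCofactor_of_ratThinCombDvdUpToTwo
    (hK2 : Summit.BirchSwinnertonDyer.BirchSwinnertonDyer.Theses.UniversalToricDescent.RatThinCombDvdUpToTwoAtThree) :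
    RatThinCombDvdLineSqfreeCofactorAtThree := by
  intro W _ _ N _ K _ _ Dt hO6 hsurj hrk hN hK hH 𝔭 h3 hram hdeg 𝔭' h3' hne ι' hι κ₁ κ₂ γ₁ γ₂ _ hur₁ hfin htors g hg
    ΩK' C X Y L₂ hΩK' hC hX hY hL₂ κ hκ γ _ k hker hγ₁ hγ₂ c hc τ hτ A hA hAA hb hGsym hLsym
  have hcomb := hK2 W N K Dt hO6 hsurj hrk hN hK hH 𝔭 h3 hram hdeg 𝔭' h3' hne ι' hι κ₁ κ₂ γ₁ γ₂ hur₁ hfin htors g hg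
    ΩK' C X Y L₂ hΩK' hC hX hY hL₂
  refine ⟨1, 0, 1, ?_, isSquarefreeUpTo_one _, ?_, ?_⟩
  · rw [map_one]
  · rw [pow_zero, mul_one, map_one, sub_self]
    exact Ideal.zero_mem _
  · rw [mul_one]
    exact hcomb

/-! ## §C  (PAR) proved: `R₀⟦T⟧` is factorial and parity absorption holds in every factorial domain -/

/-- `R₀⟦T⟧ = W(𝔽̄₃)⟦T⟧` (the tree's `UnrSeries 3`) is a unique factorisation domain: `R₀` is a DVR, `R₀⟦T⟧ ≅ R₀⟦X_0⟧` is regular local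
of dimension 2, and regular local rings are factorial (Auslander–Buchsbaum). [cite: Matsumura1987, Thm. 19.5, Thm. 20.3] -/
theorem uniqueFactorizationMonoid_unrSeries : UniqueFactorizationMonoid (UnrSeries 3) := by
  haveI := Summit.BirchSwinnertonDyer.Rank1Residual.X2.HidaLimitAlgebra.isDiscreteValuationRing_unrIntegers (p := 3)
  haveI := NearlyOrdinaryPresentationCA.isRegularLocalRing_mvPowerSeries_dvr (unrIntegers 3) 1
  exact Literature.AlgebraicGeometry.Resolution.uniqueFactorizationMonoid_of_isRegularLocalRing _
    (IsRegularLocalRing.of_ringEquiv (MvPowerSeries.renameEquiv (unrIntegers 3) finOneEquiv.symm).toRingEquiv.symm)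

open UniqueFactorizationMonoid in
/-- **Parity absorption in a factorial domain.** `c` prime, `h` squarefree away from `c`, `G² ∣ cᵏ·M²·h` ⟹ `G² ∣ cᵏ'·M²`
(`k' = 2·v_c(G)`): at a prime `q ≁ c`, `2v_q(G) ≤ 2v_q(M) + v_q(h) ≤ 2v_q(M) + 1`. [folklore] -/
theorem parityAbsorption_of_prime {S : Type*} [CommRing S] [IsDomain S] [UniqueFactorizationMonoid S]
    {c : S} (hc : Prime c) (G M h : S) (k : ℕ) (hh : IsSquarefreeUpTo c h)
    (hd : G ^ 2 ∣ c ^ k * M ^ 2 * h) : ∃ k' : ℕ, G ^ 2 ∣ c ^ k' * M ^ 2 := by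
  letI : StrongNormalizationMonoid S := UniqueFactorizationMonoid.strongNormalizationMonoid
  by_cases hM : M = 0
  · exact ⟨0, by rw [hM, zero_pow two_ne_zero, mul_zero]; exact dvd_zero _⟩
  have hh0 : h ≠ 0 := by
    rintro rfl
    obtain ⟨a, ha⟩ := hh 0 (dvd_zero _)
    exact pow_ne_zero a hc.ne_zero (zero_dvd_iff.mp ha)
  have hcM : c ^ k * M ^ 2 ≠ 0 := mul_ne_zero (pow_ne_zero k hc.ne_zero) (pow_ne_zero 2 hM)
  have hne : c ^ k * M ^ 2 * h ≠ 0 := mul_ne_zero hcM hh0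
  by_cases hG : G = 0
  · exfalso
    rw [hG, zero_pow two_ne_zero, zero_dvd_iff] at hd
    exact hne hd
  -- at a normalised prime `q ≠ normalize c`, `h` has multiplicity ≤ 1
  have hcount : ∀ q : S, q ≠ normalize c → Multiset.count q (normalizedFactors h) ≤ 1 := by
    intro q hq
    by_contra hlt
    push Not at hlt
    have hqmem : q ∈ normalizedFactors h := Multiset.count_pos.mp (by omega)
    have hqirr : Irreducible q := irreducible_of_normalized_factor q hqmem
    have hqn : normalize q = q := normalize_normalized_factor q hqmem
    have hqq : q * q ∣ h := by
      rw [dvd_iff_normalizedFactors_le_normalizedFactors (mul_ne_zero hqirr.ne_zero hqirr.ne_zero) hh0,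
        normalizedFactors_mul hqirr.ne_zero hqirr.ne_zero, normalizedFactors_irreducible hqirr, hqn,
        Multiset.le_iff_count]
      intro a
      rw [Multiset.count_add, Multiset.count_singleton]
      split_ifs with ha
      · subst ha; omega
      · simp
    obtain ⟨a, ha⟩ := hh q hqq
    have hqc : q ∣ c := (prime_of_normalized_factor q hqmem).dvd_of_dvd_pow ha
    have hassoc : Associated c q := (hc.irreducible.dvd_iff.mp hqc).resolve_left hqirr.not_isUnit
    exact hq (by rw [← hqn]; exact normalize_eq_normalize hqc hassoc.dvd)
  rw [dvd_iff_normalizedFactors_le_normalizedFactors (pow_ne_zero 2 hG) hne, normalizedFactors_mul hcM hh0,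
    normalizedFactors_mul (pow_ne_zero k hc.ne_zero) (pow_ne_zero 2 hM), normalizedFactors_pow, normalizedFactors_pow,
    normalizedFactors_pow, normalizedFactors_irreducible hc.irreducible, Multiset.le_iff_count] at hd
  refine ⟨2 * Multiset.count (normalize c) (normalizedFactors G), ?_⟩
  have hcM' : c ^ (2 * Multiset.count (normalize c) (normalizedFactors G)) * M ^ 2 ≠ 0 :=
    mul_ne_zero (pow_ne_zero _ hc.ne_zero) (pow_ne_zero 2 hM)
  rw [dvd_iff_normalizedFactors_le_normalizedFactors (pow_ne_zero 2 hG) hcM',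
    normalizedFactors_mul (pow_ne_zero _ hc.ne_zero) (pow_ne_zero 2 hM), normalizedFactors_pow, normalizedFactors_pow,
    normalizedFactors_pow, normalizedFactors_irreducible hc.irreducible, Multiset.le_iff_count]
  intro a
  have ha := hd a
  simp only [Multiset.count_add, Multiset.count_nsmul, Multiset.count_singleton] at ha ⊢
  by_cases han : a = normalize c
  · subst han
    simp only [if_true] at ha ⊢
    omega
  · have h1 := hcount a han
    simp only [han, if_false] at ha ⊢
    omega

/-- **(PAR) `ParityAbsorptionAtThree` (g26's support piece) PROVED.** [cite: Matsumura1987, Thm. 20.3] -/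
theorem parityAbsorptionAtThree : ParityAbsorptionAtThree := by
  intro G M h k hh hd
  haveI := uniqueFactorizationMonoid_unrSeries
  have h3 : Prime (((3 : ℕ) : UnrSeries 3)) := by
    have heq : ((3 : ℕ) : UnrSeries 3) = PowerSeries.C (((3 : ℕ) : unrIntegers 3)) := by rw [map_natCast]
    rw [heq]
    haveI := Summit.BirchSwinnertonDyer.Rank1Residual.X2.HidaLimitAlgebra.isDiscreteValuationRing_unrIntegers (p := 3)
    exact Literature.NumberTheory.EllipticCurves.prime_C_of_prime
      (Summit.BirchSwinnertonDyer.Rank1Residual.X2.HidaLimitAlgebra.irreducible_natCast_p (p := 3)).prime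
  exact parityAbsorption_of_prime h3 G M h k hh hd

/-- g26's square-rows door with (PAR) discharged: (SQ) ∧ (AN) ∧ (SQC) ⟹ the crux. -/
theorem rationalSplitIMCInclusionAtThree_of_squarefreeCofactor
    (hSQ : SquareCharGeneratorAtThree) (hAN : SquareRootLFunctionAtThree) (hSQC : SquarefreeCofactorInclusionAtThree) :
    Summit.BirchSwinnertonDyer.BirchSwinnertonDyer.Theses.UniversalToricDescent.RationalSplitIMCInclusionAtThree :=
  rationalSplitIMCInclusionAtThree_of_squarefreeCofactorParity hSQ hAN parityAbsorptionAtThree hSQC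

/-! ## §D  The doors -/

/-- **DOOR 1 (all rows, concludes the crux BY NAME): (E|L) ∧ Jacquet ∧ Nekovář ∧ (CFU) ⟹ `RationalSplitIMCInclusionAtThree`.**
V89's composition with the cofactor inserted: rigidity for `F := L₂·H` (symmetric because both factors are), descent for
`L♮ := v·spec_{3^k} L₂` (the line congruence `L₂·H ≡ 3^b·v·spec L₂ (mod 𝔞_k)`), the unit `v` stripped at the end. -/
theorem rationalSplitIMCInclusionAtThree_of_lineUnitCofactor
    (hE' : Summit.BirchSwinnertonDyer.BirchSwinnertonDyer.Theorems.UniversalToricDescentToricFrameExistsOfBDPDefs.ToricFrameExistsOfBDPFrameAtThree)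
    (hJ : Literature.NumberTheory.EllipticCurves.jacquet1972_functionalEquation_rankinSelbergHecke_cone)
    (hNek : Literature.NumberTheory.EllipticCurves.nekovar2006_xGr₂_isTorsion_iff_and_charIdeal_eq_map_inv)
    (hCF : RatThinCombDvdLineUnitCofactorAtThree) :
    Summit.BirchSwinnertonDyer.BirchSwinnertonDyer.Theses.UniversalToricDescent.RationalSplitIMCInclusionAtThree := by
  have hK4 := charIdealSymm_of_charIdealInvSymm (charIdealInvSymmUpTo2_of_nekovar hNek)
  intro W _ _ N _ K _ _ Dt hO6 hsurj hrk hN hK hH κ hκ γ hγ 𝔭 h3 hram hdeg 𝔭' h3' hne ι' hι ΩK Ωp L hΩK hΩp hL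
  by_cases hL0 : L = 0
  · exact ⟨0, by rw [hL0, mul_zero]; exact Ideal.zero_mem _⟩
  obtain ⟨κ₁, κ₂, γ₁, γ₂, k, hpair, hur₁, hker, hγ₁, hγ₂⟩ :=
    Summit.BirchSwinnertonDyer.BirchSwinnertonDyer.Theorems.UniversalToricDescentThinCombLine.stub_frame
      K hK κ hκ γ hγ.out 𝔭 h3 𝔭' h3' hne
  haveI : Fact (ZpExtension.IsTopGeneratorPair κ₁ κ₂ γ₁ γ₂) := ⟨hpair⟩
  obtain ⟨g₂, hg₂⟩ :=
    Summit.BirchSwinnertonDyer.BirchSwinnertonDyer.Theorems.UniversalToricDescentThinCombLine.stub_charIdealPrincipal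
      ((W.baseChange K).XGr₂ 3 κ₁ κ₂ 𝔭' γ₁ γ₂)
  have hg₂' : Literature.NumberTheory.EllipticCurves.Module.charIdeal (IwasawaAlgebra₂ 3)
      ((W.baseChange K).XGr₂ 3 κ₁ κ₂ 𝔭' γ₁ γ₂) = Ideal.span {g₂} := by
    simpa [Ideal.submodule_span_eq] using hg₂
  have hfin : Module.Finite (IwasawaAlgebra₂ 3) ((W.baseChange K).XGr₂ 3 κ₁ κ₂ 𝔭' γ₁ γ₂) :=
    Summit.BirchSwinnertonDyer.BirchSwinnertonDyer.Theorems.SignedBaseChangeAcDivFinitePiece.xGr₂_module_finite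
      (W.baseChange K) 3 κ₁ κ₂ 𝔭'
  obtain ⟨c, hc⟩ := FrameInvolution.exists_not_mem_range_absGaloisRestrict_rat hK
  obtain ⟨τ, hτ⟩ := FrameInvolution.exists_conjInv hK.1 c
  obtain ⟨A, hA, hAA⟩ := FrameInvolution.exists_GL_eq_frameMatrixOf_of_conjInv (p := 3) hK hpair hτ
  obtain ⟨ΩK', C, X, Y, L₂, hΩK', hC, hX, hY, hL₂⟩ :=
    hE' W N K Dt hO6 hsurj hrk hN hK hH κ hκ γ 𝔭 h3 hram hdeg 𝔭' h3' hne ι' hι ΩK Ωp L hΩK hΩp hL hL0 κ₁ κ₂ γ₁ γ₂ k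
      hur₁ hker hγ₁ hγ₂
  have hLsym := FrameFunctionalEquation.associated_frameSubst hJ hK W Dt hH h3 h3' hne ι' hι hpair hur₁ hc hτ A hA hX hY hL₂
  rcases Summit.BirchSwinnertonDyer.BirchSwinnertonDyer.Theorems.UniversalToricDescentRatwallThinComb.ContRigidityUpTo.eq_zero_or_rel_spec_of_toricUpTo₂_values
      K N Dt.f hK κ hκ γ hγ.out 𝔭 h3 𝔭' h3' hne ι' κ₁ κ₂ γ₁ γ₂ k hpair hγ₁ hγ₂ hΩK hΩp hL hΩK' hC hX hY
      (fun ψ a b ha hb hinf hunr r hr hκr Lc hLd hLe ↦ hL₂.hasValueAt₂ ha hb hinf hunr hr hκr hLd hLe) with h0 | ⟨a₀, b₀, w, hw, hrel⟩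
  · exact ⟨0, by rw [h0, mul_zero]; exact Ideal.zero_mem _⟩
  by_cases htors : Module.IsTorsion (IwasawaAlgebra₂ 3) ((W.baseChange K).XGr₂ 3 κ₁ κ₂ 𝔭' γ₁ γ₂)
  swap
  · have hnt := Summit.BirchSwinnertonDyer.BirchSwinnertonDyer.Theorems.UniversalToricDescentThinCombLine.stub_torsionTransfer
      W K hO6 hsurj hK κ hκ γ 𝔭 h3 𝔭' h3' hne κ₁ κ₂ γ₁ γ₂ k hur₁ hker hγ₁ hγ₂ htors
    refine ⟨0, ?_⟩
    rw [pow_zero, one_mul]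
    exact (Ideal.span_singleton_le_iff_mem _).mp
      (Summit.BirchSwinnertonDyer.BirchSwinnertonDyer.Theorems.UniversalToricDescentCharIdealVacuity.span_le_map_charIdeal_of_not_isTorsion
        hnt _ L)
  have hGsym :=
    hK4 W N K Dt hO6 hsurj hrk hN hK hH 𝔭 h3 hram hdeg 𝔭' h3' hne κ₁ κ₂ γ₁ γ₂
      hur₁ hfin htors g₂ hg₂' c hc τ hτ A hA
  have hb : (A : Matrix (Fin 2) (Fin 2) ℤ_[3]) 0 1 ≠ 0 :=
    FrameInvolution.frameMatrixOf_zero_one_ne_zero_of_natCast_mem hK hpair h3 h3' hne hur₁ hc hτ hA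
  -- (CFU): the symmetric line-unit cofactor `H` and the comb divisibility of `L₂·H`
  obtain ⟨H, b, v, hHsym, hHline, hcomb⟩ :=
    hCF W N K Dt hO6 hsurj hrk hN hK hH 𝔭 h3 hram hdeg 𝔭' h3' hne ι' hι κ₁ κ₂ γ₁ γ₂
      hur₁ hfin htors g₂ hg₂' ΩK' C X Y L₂ hΩK' hC hX hY hL₂ κ hκ γ k hker hγ₁ hγ₂ c hc τ hτ A hA hAA hb hGsym hLsym
  letI : Algebra ℤ_[3] (unrIntegers 3) := (Summit.BirchSwinnertonDyer.Rank1Residual.X11b.Halves.toUnr 3).toAlgebra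
  haveI := Summit.BirchSwinnertonDyer.Rank1Residual.X2.HidaLimitAlgebra.isDiscreteValuationRing_unrIntegers (p := 3)
  have hmax : IsLocalRing.maximalIdeal (unrIntegers 3) = Ideal.span {((3 : ℕ) : unrIntegers 3)} :=
    (IsDiscreteValuationRing.irreducible_iff_uniformizer _).mp
      Summit.BirchSwinnertonDyer.Rank1Residual.X2.HidaLimitAlgebra.irreducible_natCast_p
  have hF : Associated (IwasawaAlgebra₂.frameSubst (unrIntegers 3) A (L₂ * H)) (L₂ * H) := by
    rw [map_mul]
    exact hLsym.mul_mul hHsym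
  obtain ⟨a, hdvd⟩ := dvd_pow_mul_of_weakReflection (unrIntegers 3) 3 hmax (IwasawaAlgebra₂.frameSubst (unrIntegers 3) A)
    (GroupLikeReflection.frameSubst_const (unrIntegers 3) A)
    (GroupLikeReflection.frameSubst_T₂_not_mem (unrIntegers 3) A
      Summit.BirchSwinnertonDyer.Rank1Residual.X2.HidaLimitAlgebra.irreducible_natCast_p.not_isUnit hb)
    _ (L₂ * H) hGsym hF hcomb
  have hPN :=
    Summit.BirchSwinnertonDyer.BirchSwinnertonDyer.Theorems.UniversalToricDescentThinComb.NoPseudoNullOfPoitouTate.stub_noPseudoNull_of_poitouTateAt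
      Summit.BirchSwinnertonDyer.BirchSwinnertonDyer.Theorems.PoitouTateShaNaturalAtTC.forall_poitouTate_shaRestricted_tateDual_natural_at_of_isTotallyComplex
      W K hO6 hsurj hK κ hκ γ 𝔭 h3 𝔭' h3' hne κ₁ κ₂ γ₁ γ₂ k hur₁ hker hγ₁ hγ₂ hfin htors
  -- the comparison clause for `L♮ := v·spec (3^k) L₂` with `u = 1`, `t = 0`, `s = b`
  have hcmp : ∃ (u : (PowerSeries (PowerSeries (unrIntegers 3)))ˣ) (t s : ℕ),
      const (unrIntegers 3) (((3 : ℕ) : unrIntegers 3) ^ t) * (L₂ * H) -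
        u * const (unrIntegers 3) (((3 : ℕ) : unrIntegers 3) ^ s) *
          PowerSeries.map (PowerSeries.C (R := unrIntegers 3)) ((v : UnrSeries 3) * TwoVarSubst.spec (3 ^ k) L₂) ∈
        Ideal.span {T₂ (unrIntegers 3) - ((1 + T₁ (unrIntegers 3)) ^ (3 ^ k) - 1)} := by
    refine ⟨1, 0, b, ?_⟩
    have h1 := LineValue.sub_one_mul_map_spec_mem_lineIdeal (3 ^ k) L₂
    have key : const (unrIntegers 3) (((3 : ℕ) : unrIntegers 3) ^ 0) * (L₂ * H) -
        ((1 : (PowerSeries (PowerSeries (unrIntegers 3)))ˣ) : PowerSeries (PowerSeries (unrIntegers 3))) *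
          const (unrIntegers 3) (((3 : ℕ) : unrIntegers 3) ^ b) *
          PowerSeries.map (PowerSeries.C (R := unrIntegers 3)) ((v : UnrSeries 3) * TwoVarSubst.spec (3 ^ k) L₂) =
        (L₂ - ((1 : (PowerSeries (PowerSeries (unrIntegers 3)))ˣ) : PowerSeries (PowerSeries (unrIntegers 3))) *
            PowerSeries.map (PowerSeries.C (R := unrIntegers 3)) (TwoVarSubst.spec (3 ^ k) L₂)) * H +
          PowerSeries.map (PowerSeries.C (R := unrIntegers 3)) (TwoVarSubst.spec (3 ^ k) L₂) *
            (H - PowerSeries.map (PowerSeries.C (R := unrIntegers 3)) (((3 : ℕ) : UnrSeries 3) ^ b * (v : UnrSeries 3))) := by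
      simp only [map_pow, map_natCast, map_mul, map_one, Units.val_one, one_mul, pow_zero]
      ring
    rw [key]
    exact Ideal.add_mem _ (Ideal.mul_mem_right _ _ h1) (Ideal.mul_mem_left _ _ hHline)
  obtain ⟨k', hk'⟩ :=
    Summit.BirchSwinnertonDyer.BirchSwinnertonDyer.Cruxes.ToricTransportModThree.RatwallThinComb.stub_ratDescent
      W K hO6 hsurj hK κ hκ γ 𝔭 h3 𝔭' h3' hne κ₁ κ₂ γ₁ γ₂ k hur₁ hker hγ₁ hγ₂ hfin htors hPN g₂ hg₂' (L₂ * H)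
      ((v : UnrSeries 3) * TwoVarSubst.spec (3 ^ k) L₂) a hdvd hcmp
  -- strip the unit `v`, then transport along `3^a₀·spec L₂ = 3^b₀·(w·L)`
  have hk'' : ((3 : ℕ) : UnrSeries 3) ^ k' * TwoVarSubst.spec (3 ^ k) L₂ ∈
      (Summit.BirchSwinnertonDyer.Rank1Residual.X11b.AcSelmer.XAc.charIdeal (W.baseChange K) 3 κ 𝔭' ∅ γ).map
        (PowerSeries.map (Summit.BirchSwinnertonDyer.Rank1Residual.X11b.Halves.toUnr 3)) := by
    have e : ((3 : ℕ) : UnrSeries 3) ^ k' * TwoVarSubst.spec (3 ^ k) L₂ =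
        ((v⁻¹ : (UnrSeries 3)ˣ) : UnrSeries 3) * (((3 : ℕ) : UnrSeries 3) ^ k' * ((v : UnrSeries 3) * TwoVarSubst.spec (3 ^ k) L₂)) := by
      rw [mul_left_comm, ← mul_assoc ((v⁻¹ : (UnrSeries 3)ˣ) : UnrSeries 3), Units.inv_mul, one_mul]
    rw [e]
    exact Ideal.mul_mem_left _ _ hk'
  exact ⟨k' + b₀,
    Summit.BirchSwinnertonDyer.BirchSwinnertonDyer.Theorems.UniversalToricDescentRatwallThinComb.ContRigidityUpTo.pow_mul_mem_of_rel
      hw hrel hk''⟩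

/-- **DOOR 2a: (E|L) ∧ Jacquet ∧ Nekovář ∧ (CFS) ⟹ g26's (SQC) `SquarefreeCofactorInclusionAtThree`** (every row). -/
theorem squarefreeCofactorInclusion_of_lineSqfreeCofactor
    (hE' : Summit.BirchSwinnertonDyer.BirchSwinnertonDyer.Theorems.UniversalToricDescentToricFrameExistsOfBDPDefs.ToricFrameExistsOfBDPFrameAtThree)
    (hJ : Literature.NumberTheory.EllipticCurves.jacquet1972_functionalEquation_rankinSelbergHecke_cone)
    (hNek : Literature.NumberTheory.EllipticCurves.nekovar2006_xGr₂_isTorsion_iff_and_charIdeal_eq_map_inv)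
    (hCF : RatThinCombDvdLineSqfreeCofactorAtThree) :
    SquarefreeCofactorInclusionAtThree := by
  have hK4 := charIdealSymm_of_charIdealInvSymm (charIdealInvSymmUpTo2_of_nekovar hNek)
  intro W _ _ N _ K _ _ Dt hO6 hsurj hrk hN hK hH κ hκ γ hγ 𝔭 h3 hram hdeg 𝔭' h3' hne ι' hι ΩK Ωp L hΩK hΩp hL
  by_cases hL0 : L = 0
  · exact ⟨0, 1, isSquarefreeUpTo_one _, by rw [hL0, mul_zero, zero_mul]; exact Ideal.zero_mem _⟩
  obtain ⟨κ₁, κ₂, γ₁, γ₂, k, hpair, hur₁, hker, hγ₁, hγ₂⟩ :=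
    Summit.BirchSwinnertonDyer.BirchSwinnertonDyer.Theorems.UniversalToricDescentThinCombLine.stub_frame
      K hK κ hκ γ hγ.out 𝔭 h3 𝔭' h3' hne
  haveI : Fact (ZpExtension.IsTopGeneratorPair κ₁ κ₂ γ₁ γ₂) := ⟨hpair⟩
  obtain ⟨g₂, hg₂⟩ :=
    Summit.BirchSwinnertonDyer.BirchSwinnertonDyer.Theorems.UniversalToricDescentThinCombLine.stub_charIdealPrincipal
      ((W.baseChange K).XGr₂ 3 κ₁ κ₂ 𝔭' γ₁ γ₂)
  have hg₂' : Literature.NumberTheory.EllipticCurves.Module.charIdeal (IwasawaAlgebra₂ 3)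
      ((W.baseChange K).XGr₂ 3 κ₁ κ₂ 𝔭' γ₁ γ₂) = Ideal.span {g₂} := by
    simpa [Ideal.submodule_span_eq] using hg₂
  have hfin : Module.Finite (IwasawaAlgebra₂ 3) ((W.baseChange K).XGr₂ 3 κ₁ κ₂ 𝔭' γ₁ γ₂) :=
    Summit.BirchSwinnertonDyer.BirchSwinnertonDyer.Theorems.SignedBaseChangeAcDivFinitePiece.xGr₂_module_finite
      (W.baseChange K) 3 κ₁ κ₂ 𝔭'
  obtain ⟨c, hc⟩ := FrameInvolution.exists_not_mem_range_absGaloisRestrict_rat hK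
  obtain ⟨τ, hτ⟩ := FrameInvolution.exists_conjInv hK.1 c
  obtain ⟨A, hA, hAA⟩ := FrameInvolution.exists_GL_eq_frameMatrixOf_of_conjInv (p := 3) hK hpair hτ
  obtain ⟨ΩK', C, X, Y, L₂, hΩK', hC, hX, hY, hL₂⟩ :=
    hE' W N K Dt hO6 hsurj hrk hN hK hH κ hκ γ 𝔭 h3 hram hdeg 𝔭' h3' hne ι' hι ΩK Ωp L hΩK hΩp hL hL0 κ₁ κ₂ γ₁ γ₂ k
      hur₁ hker hγ₁ hγ₂
  have hLsym := FrameFunctionalEquation.associated_frameSubst hJ hK W Dt hH h3 h3' hne ι' hι hpair hur₁ hc hτ A hA hX hY hL₂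
  rcases Summit.BirchSwinnertonDyer.BirchSwinnertonDyer.Theorems.UniversalToricDescentRatwallThinComb.ContRigidityUpTo.eq_zero_or_rel_spec_of_toricUpTo₂_values
      K N Dt.f hK κ hκ γ hγ.out 𝔭 h3 𝔭' h3' hne ι' κ₁ κ₂ γ₁ γ₂ k hpair hγ₁ hγ₂ hΩK hΩp hL hΩK' hC hX hY
      (fun ψ a b ha hb hinf hunr r hr hκr Lc hLd hLe ↦ hL₂.hasValueAt₂ ha hb hinf hunr hr hκr hLd hLe) with h0 | ⟨a₀, b₀, w, hw, hrel⟩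
  · exact ⟨0, 1, isSquarefreeUpTo_one _, by rw [h0, mul_zero, zero_mul]; exact Ideal.zero_mem _⟩
  by_cases htors : Module.IsTorsion (IwasawaAlgebra₂ 3) ((W.baseChange K).XGr₂ 3 κ₁ κ₂ 𝔭' γ₁ γ₂)
  swap
  · have hnt := Summit.BirchSwinnertonDyer.BirchSwinnertonDyer.Theorems.UniversalToricDescentThinCombLine.stub_torsionTransfer
      W K hO6 hsurj hK κ hκ γ 𝔭 h3 𝔭' h3' hne κ₁ κ₂ γ₁ γ₂ k hur₁ hker hγ₁ hγ₂ htors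
    refine ⟨0, 1, isSquarefreeUpTo_one _, ?_⟩
    rw [pow_zero, one_mul, mul_one]
    exact (Ideal.span_singleton_le_iff_mem _).mp
      (Summit.BirchSwinnertonDyer.BirchSwinnertonDyer.Theorems.UniversalToricDescentCharIdealVacuity.span_le_map_charIdeal_of_not_isTorsion
        hnt _ L)
  have hGsym :=
    hK4 W N K Dt hO6 hsurj hrk hN hK hH 𝔭 h3 hram hdeg 𝔭' h3' hne κ₁ κ₂ γ₁ γ₂
      hur₁ hfin htors g₂ hg₂' c hc τ hτ A hA
  have hb : (A : Matrix (Fin 2) (Fin 2) ℤ_[3]) 0 1 ≠ 0 :=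
    FrameInvolution.frameMatrixOf_zero_one_ne_zero_of_natCast_mem hK hpair h3 h3' hne hur₁ hc hτ hA
  obtain ⟨H, b, h, hHsym, hh, hHline, hcomb⟩ :=
    hCF W N K Dt hO6 hsurj hrk hN hK hH 𝔭 h3 hram hdeg 𝔭' h3' hne ι' hι κ₁ κ₂ γ₁ γ₂
      hur₁ hfin htors g₂ hg₂' ΩK' C X Y L₂ hΩK' hC hX hY hL₂ κ hκ γ k hker hγ₁ hγ₂ c hc τ hτ A hA hAA hb hGsym hLsym
  letI : Algebra ℤ_[3] (unrIntegers 3) := (Summit.BirchSwinnertonDyer.Rank1Residual.X11b.Halves.toUnr 3).toAlgebra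
  haveI := Summit.BirchSwinnertonDyer.Rank1Residual.X2.HidaLimitAlgebra.isDiscreteValuationRing_unrIntegers (p := 3)
  have hmax : IsLocalRing.maximalIdeal (unrIntegers 3) = Ideal.span {((3 : ℕ) : unrIntegers 3)} :=
    (IsDiscreteValuationRing.irreducible_iff_uniformizer _).mp
      Summit.BirchSwinnertonDyer.Rank1Residual.X2.HidaLimitAlgebra.irreducible_natCast_p
  have hF : Associated (IwasawaAlgebra₂.frameSubst (unrIntegers 3) A (L₂ * H)) (L₂ * H) := by
    rw [map_mul]
    exact hLsym.mul_mul hHsym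
  obtain ⟨a, hdvd⟩ := dvd_pow_mul_of_weakReflection (unrIntegers 3) 3 hmax (IwasawaAlgebra₂.frameSubst (unrIntegers 3) A)
    (GroupLikeReflection.frameSubst_const (unrIntegers 3) A)
    (GroupLikeReflection.frameSubst_T₂_not_mem (unrIntegers 3) A
      Summit.BirchSwinnertonDyer.Rank1Residual.X2.HidaLimitAlgebra.irreducible_natCast_p.not_isUnit hb)
    _ (L₂ * H) hGsym hF hcomb
  have hPN :=
    Summit.BirchSwinnertonDyer.BirchSwinnertonDyer.Theorems.UniversalToricDescentThinComb.NoPseudoNullOfPoitouTate.stub_noPseudoNull_of_poitouTateAt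
      Summit.BirchSwinnertonDyer.BirchSwinnertonDyer.Theorems.PoitouTateShaNaturalAtTC.forall_poitouTate_shaRestricted_tateDual_natural_at_of_isTotallyComplex
      W K hO6 hsurj hK κ hκ γ 𝔭 h3 𝔭' h3' hne κ₁ κ₂ γ₁ γ₂ k hur₁ hker hγ₁ hγ₂ hfin htors
  have hcmp : ∃ (u : (PowerSeries (PowerSeries (unrIntegers 3)))ˣ) (t s : ℕ),
      const (unrIntegers 3) (((3 : ℕ) : unrIntegers 3) ^ t) * (L₂ * H) -
        u * const (unrIntegers 3) (((3 : ℕ) : unrIntegers 3) ^ s) *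
          PowerSeries.map (PowerSeries.C (R := unrIntegers 3)) (h * TwoVarSubst.spec (3 ^ k) L₂) ∈
        Ideal.span {T₂ (unrIntegers 3) - ((1 + T₁ (unrIntegers 3)) ^ (3 ^ k) - 1)} := by
    refine ⟨1, 0, b, ?_⟩
    have h1 := LineValue.sub_one_mul_map_spec_mem_lineIdeal (3 ^ k) L₂
    have key : const (unrIntegers 3) (((3 : ℕ) : unrIntegers 3) ^ 0) * (L₂ * H) -
        ((1 : (PowerSeries (PowerSeries (unrIntegers 3)))ˣ) : PowerSeries (PowerSeries (unrIntegers 3))) *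
          const (unrIntegers 3) (((3 : ℕ) : unrIntegers 3) ^ b) *
          PowerSeries.map (PowerSeries.C (R := unrIntegers 3)) (h * TwoVarSubst.spec (3 ^ k) L₂) =
        (L₂ - ((1 : (PowerSeries (PowerSeries (unrIntegers 3)))ˣ) : PowerSeries (PowerSeries (unrIntegers 3))) *
            PowerSeries.map (PowerSeries.C (R := unrIntegers 3)) (TwoVarSubst.spec (3 ^ k) L₂)) * H +
          PowerSeries.map (PowerSeries.C (R := unrIntegers 3)) (TwoVarSubst.spec (3 ^ k) L₂) *
            (H - PowerSeries.map (PowerSeries.C (R := unrIntegers 3)) (((3 : ℕ) : UnrSeries 3) ^ b * h)) := by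
      simp only [map_pow, map_natCast, map_mul, map_one, Units.val_one, one_mul, pow_zero]
      ring
    rw [key]
    exact Ideal.add_mem _ (Ideal.mul_mem_right _ _ h1) (Ideal.mul_mem_left _ _ hHline)
  obtain ⟨k', hk'⟩ :=
    Summit.BirchSwinnertonDyer.BirchSwinnertonDyer.Cruxes.ToricTransportModThree.RatwallThinComb.stub_ratDescent
      W K hO6 hsurj hK κ hκ γ 𝔭 h3 𝔭' h3' hne κ₁ κ₂ γ₁ γ₂ k hur₁ hker hγ₁ hγ₂ hfin htors hPN g₂ hg₂' (L₂ * H)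
      (h * TwoVarSubst.spec (3 ^ k) L₂) a hdvd hcmp
  -- transport along `3^a₀·spec L₂ = 3^b₀·(w·L)`: the cofactor becomes `w·h`, still squarefree away from 3
  refine ⟨k' + b₀, w * h, hh.of_unit_mul hw, ?_⟩
  have e : ((3 : ℕ) : UnrSeries 3) ^ (k' + b₀) * L * (w * h) =
      PowerSeries.C (((3 : ℕ) : unrIntegers 3) ^ a₀) * (((3 : ℕ) : UnrSeries 3) ^ k' * (h * TwoVarSubst.spec (3 ^ k) L₂)) := by
    rw [pow_add,
      Summit.BirchSwinnertonDyer.BirchSwinnertonDyer.Theorems.UniversalToricDescentRatwallThinComb.ContRigidityUpTo.natCast_pow_eq_C_pow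
        (p := 3) b₀]
    calc ((3 : ℕ) : UnrSeries 3) ^ k' * PowerSeries.C (((3 : ℕ) : unrIntegers 3) ^ b₀) * L * (w * h)
        = ((3 : ℕ) : UnrSeries 3) ^ k' * h * (PowerSeries.C (((3 : ℕ) : unrIntegers 3) ^ b₀) * (w * L)) := by ring
      _ = ((3 : ℕ) : UnrSeries 3) ^ k' * h * (PowerSeries.C (((3 : ℕ) : unrIntegers 3) ^ a₀) * TwoVarSubst.spec (3 ^ k) L₂) := by
          rw [hrel]
      _ = PowerSeries.C (((3 : ℕ) : unrIntegers 3) ^ a₀) * (((3 : ℕ) : UnrSeries 3) ^ k' * (h * TwoVarSubst.spec (3 ^ k) L₂)) := by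
          ring
  rw [e]
  exact Ideal.mul_mem_left _ _ hk'

/-- **DOOR 2 (square rows, concludes the crux BY NAME): (E|L) ∧ Jacquet ∧ Nekovář ∧ (CFS) ∧ (SQ) ∧ (AN) ⟹ `RationalSplitIMCInclusionAtThree`**
(g26's format door with (PAR) proved). -/
theorem rationalSplitIMCInclusionAtThree_of_lineSqfreeCofactor
    (hE' : Summit.BirchSwinnertonDyer.BirchSwinnertonDyer.Theorems.UniversalToricDescentToricFrameExistsOfBDPDefs.ToricFrameExistsOfBDPFrameAtThree)
    (hJ : Literature.NumberTheory.EllipticCurves.jacquet1972_functionalEquation_rankinSelbergHecke_cone)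
    (hNek : Literature.NumberTheory.EllipticCurves.nekovar2006_xGr₂_isTorsion_iff_and_charIdeal_eq_map_inv)
    (hCF : RatThinCombDvdLineSqfreeCofactorAtThree)
    (hSQ : SquareCharGeneratorAtThree) (hAN : SquareRootLFunctionAtThree) :
    Summit.BirchSwinnertonDyer.BirchSwinnertonDyer.Theses.UniversalToricDescent.RationalSplitIMCInclusionAtThree :=
  rationalSplitIMCInclusionAtThree_of_squarefreeCofactor hSQ hAN
    (squarefreeCofactorInclusion_of_lineSqfreeCofactor hE' hJ hNek hCF)

/-! ## §E  B-g27-1 certificate: WITHOUT symmetry the comb sees nothing of the `(3,T₂)`-class (`G = T₂` comb-divides everything) -/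

/-- `G = T₂` rationally comb-divides EVERY `F` (`t = 1`): `3 = E_m(T₂) − T₂·q_m ∈ (T₂, E_m)` since `E_m(0) = Φ_{3^{m+1}}(1) = 3`. -/
theorem thinCombDvdRat_T₂ (𝒪 : Type*) [CommRing 𝒪] (F : PowerSeries (PowerSeries 𝒪)) :
    ThinCombDvdRat 𝒪 3 (T₂ 𝒪) F := by
  intro n
  refine ⟨n, le_rfl, 1, ?_⟩
  have hX : (PowerSeries.X : PowerSeries 𝒪) ∣ combSeries 𝒪 3 n - PowerSeries.C (((3 : ℕ) : 𝒪)) := by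
    rw [PowerSeries.X_dvd_iff, map_sub, constantCoeff_combSeries, PowerSeries.constantCoeff_C, sub_self]
  obtain ⟨q, hq⟩ := hX
  have key : const 𝒪 (((3 : ℕ) : 𝒪) ^ 1) = combElt 𝒪 3 n - T₂ 𝒪 * PowerSeries.C q := by
    rw [pow_one]
    change PowerSeries.C (PowerSeries.C ((3 : ℕ) : 𝒪)) =
      PowerSeries.C (combSeries 𝒪 3 n) - PowerSeries.C PowerSeries.X * PowerSeries.C q
    rw [← map_mul, ← map_sub, ← hq, sub_sub_cancel]
  rw [key, sub_mul]
  refine Ideal.sub_mem _ (Ideal.mul_mem_right _ _ (Ideal.subset_span (by simp)))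
    (Ideal.mul_mem_right _ _ (Ideal.mul_mem_right _ _ (Ideal.subset_span (by simp))))

/-- … yet over `ℤ` (indeed over any `𝒪` in which `3` is not nilpotent) `T₂ ∤ 3^a·1` for every `a`: the bare cofactor-free or
asymmetric-cofactor comb format is VOID on the `(3,T₂)`-class; only `φ_A`-symmetry (hypothesis `φ_A T₂ ∉ (3,T₂)`) excludes it. -/
theorem not_T₂_dvd_const_pow (a : ℕ) : ¬ T₂ ℤ ∣ const ℤ (((3 : ℕ) : ℤ) ^ a) * 1 := by
  rintro ⟨y, hy⟩
  have h0 := congrArg (PowerSeries.constantCoeff (R := PowerSeries ℤ)) hy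
  rw [mul_one] at h0
  change PowerSeries.constantCoeff (PowerSeries.C (PowerSeries.C (((3 : ℕ) : ℤ) ^ a))) =
    PowerSeries.constantCoeff (PowerSeries.C PowerSeries.X * y) at h0
  rw [map_mul, PowerSeries.constantCoeff_C, PowerSeries.constantCoeff_C] at h0
  have hX : (PowerSeries.X : PowerSeries ℤ) ∣ PowerSeries.C (((3 : ℕ) : ℤ) ^ a) := ⟨_, h0⟩
  rw [PowerSeries.X_dvd_iff, PowerSeries.constantCoeff_C] at hX
  exact pow_ne_zero a (by norm_num) hX

end Summit.BirchSwinnertonDyer.BirchSwinnertonDyer.Cruxes.RationalSplitIMCInclusionAtThree.CrossingLocalCofactor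

end
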